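import Mathlib.Analysis.SpecialFunctions.Integrals.Basic
import Mathlib.Analysis.SpecialFunctions.Pow.Real
import Mathlib.Analysis.SpecialFunctions.Log.Basic
import Mathlib.Topology.Algebra.InfiniteSum.Real
import Mathlib.Algebra.Order.Field.GeomSum
import Mathlib.Analysis.Normed.Group.FunctionSeries
import Mathlib.MeasureTheory.Integral.DominatedConvergence
import HarnessLib

/-!
# Lacunary sums of Gaussian scale factors: `∑ₖ N_k^a e^{-c N_k² t} ≲ t^{-a/2}` and the
# logarithmic loss `∫ t^{-1/2} ∑ₖ N_k e^{-c N_k² t} dt ≲ 1 + log(t₂/t₁)/log ρ`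

Analysis/FluidPDE support file (pure real analysis; everything proved, no definitions, no named
facts) on the discharge path of the named fact
`Literature.Barriers.NavierStokesRegularity.CoiculescuPalasek2025_principalParts`
(`Barriers/NavierStokesRegularity/CriticalDataSmoothNonuniquenessConstruction.lean`: the principal
parts of M. P. Coiculescu, S. Palasek, *Non-uniqueness of smooth solutions of the Navier–Stokes
equations from critical data*, Invent. Math. 244 (2025), arXiv:2503.14699, Def. 3.10 with
Prop. 3.13). The principal parts are lacunary series `v = ∑ₖ vₖ` over frequency scales
`N₀ < N₁ < ⋯` with `N_{k+1}/N_k ≥ A^{γ(b-1)} → ∞`, each block obeying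
`‖∇^m v_k(t)‖_∞ ≲ N_k^{1+m} e^{-N_k² t}` (proof of Prop. 3.13, display (quack)), and the two
estimates (3.13a)–(3.13b) that the perturbation argument consumes
(`CoiculescuPalasek2025.IsApproximateSolution.deriv_le` / `.lacunary_le`) are obtained from the
block bounds by the following REAL-VARIABLE facts about a lacunary sequence of scales, which are
what this file proves (for an arbitrary sequence `N : ℕ → ℝ` of positive reals with
`N (k+1) ≥ ρ N k`, `ρ ≥ 2`; all sums are over `k < n`, uniformly in `n`, with `tsum` corollaries):

* `exists_sum_rpow_mul_exp_neg_le_of_lacunary` — **(3.13a), summed**: for `a, c > 0` there is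
  `C = C(a,c)` with `∑ₖ N_k^a e^{-c N_k² t} ≤ C t^{-a/2}` for all `t > 0` ("Because `N_k` grows
  rapidly, the sum is controlled by the largest summand, which occurs near `N_k = t^{-1/2}`");
  `exists_sum_rpow_mul_exp_neg_le_exp_of_lacunary` adds the factor `e^{-c N₀² t/2}` of (3.13a);
* `card_filter_mem_Icc_le_of_lacunary` — the counting step of (3.13b):
  `#{k : L ≤ N_k ≤ U} ≤ 1 + log(U/L)/log ρ` ("`N_k` is more lacunary than the geometric sequence
  with ratio `A^{γ(b-1)}`, therefore `#{k : N_k ∈ [t₂^{-1/2}, t₁^{-1/2}]} ≤ (2γ(b-1)log A)⁻¹ log(t₂/t₁)`");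
* `integral_rpow_neg_half_mul_sum_le_of_lacunary` — **(3.13b), the weighted `L¹` bound**:
  `∫_{t₁}^{t₂} t^{-1/2} ∑ₖ N_k e^{-c N_k² t} dt ≤ 6 + 1/c + 1/c² + (1 + 1/(2c)) log(t₂/t₁)/log ρ` for
  `0 < t₁ ≤ t₂` (terms `I`, `II` of the printed proof: scales below `t₂^{-1/2}` contribute a
  geometric series, scales above `t₁^{-1/2}` a super-geometric one, and each of the
  `≤ 1 + log(t₂/t₁)/(2 log ρ)` intermediate scales at most `2 + 1/c`);
* `exists_integral_sum_sq_le_of_lacunary` — **(3.13b), the `L²` bound**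
  `∫_{t₁}^{t₂} (∑ₖ N_k e^{-c N_k² t})² dt ≤ C₁ + C₂ log(t₂/t₁)/log ρ` ("the `L²` estimate is immediate
  by Hölder's inequality, combining the `L¹` bound with (3.13a)");
* `tsum` forms: `summable_rpow_mul_exp_neg_of_lacunary`,
  `exists_tsum_rpow_mul_exp_neg_le_of_lacunary`.

The constants depend on `a` and `c` only — not on the sequence, and in particular not on the
lacunarity ratio `ρ ≥ 2`, which enters only through the slope `1/log ρ` of the logarithm, as the
paper requires (the slope `(log A)⁻¹` of (3.13b) must be small while the constant stays bounded).
The dyadic special case `N_k = 2^k` over `k ∈ ℤ` of the first bullet is the tree's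
`Literature.Analysis.FunctionSpaces.exists_tsum_rpow_mul_exp_neg_le`
(`LittlewoodPaleyConvergenceProofs`); nothing for general lacunary sequences, for the counting
bound or for the logarithmic loss exists in Mathlib or the tree
(`lean search 'acunar'`: only the fixed-ratio sums of `BourgainPavlovicBudget`, `DMVPsiTemplate`).

Proofs are the elementary ones: a lacunary sequence below a threshold is dominated by the
geometric sequence anchored at its largest member, above a threshold by the one anchored at its
smallest member (`∑ q^{M-k}`, `∑ q^{k-m} ≤ 1/(1-q)`), `x^a e^{-x²} ≤ 2^m m! e^{-x²/2}` for `x ≥ 1`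
(`m = ⌈a/2⌉`), `4^i ≥ i + 1`, and the explicit integrals `∫ t^{-1/2} = 2√t`, `∫ e^{-κt} = -e^{-κt}/κ`.

## References

* M. P. Coiculescu, S. Palasek, Invent. Math. 244 (2025) 165–219, doi:10.1007/s00222-025-01396-z,
  arXiv:2503.14699: Prop. 3.13 and its proof (displays (quack), (vweightedlinftybound),
  (vl2intimelinftyinspacebound); terms `I`, `II`, `III`), §2.4 (the scales `M_k`, `N_k`).
  [CoiculescuPalasek2025]
-/

noncomputable section

open MeasureTheory Set Filter Finset
open _root_.Topology
open scoped BigOperators Interval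

namespace Literature.Analysis.FluidPDE

/-! ## Lacunary sequences: iterated ratio bounds and anchored geometric sums -/

section Lacunary

variable {N : ℕ → ℝ} {ρ : ℝ}

/-- Iterating `ρ N_k ≤ N_{k+1}`: `ρ^i N_k ≤ N_{k+i}`. [folklore] -/
theorem pow_mul_le_of_lacunary (hρ : 0 ≤ ρ) (hlac : ∀ k, ρ * N k ≤ N (k + 1)) (k i : ℕ) :
    ρ ^ i * N k ≤ N (k + i) := by
  induction i with
  | zero => simp
  | succ i ih =>
    calc ρ ^ (i + 1) * N k = ρ * (ρ ^ i * N k) := by ring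
      _ ≤ ρ * N (k + i) := mul_le_mul_of_nonneg_left ih hρ
      _ ≤ N (k + i + 1) := hlac (k + i)
      _ = N (k + (i + 1)) := by rw [add_assoc]

/-- A lacunary sequence of non-negative reals with ratio `ρ ≥ 1` is monotone. [folklore] -/
theorem le_of_lacunary (hN : ∀ k, 0 ≤ N k) (hρ : 1 ≤ ρ) (hlac : ∀ k, ρ * N k ≤ N (k + 1))
    {k l : ℕ} (hkl : k ≤ l) : N k ≤ N l := by
  obtain ⟨i, rfl⟩ := Nat.exists_eq_add_of_le hkl
  calc N k = 1 * N k := (one_mul _).symm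
    _ ≤ ρ ^ i * N k := mul_le_mul_of_nonneg_right (one_le_pow₀ hρ) (hN k)
    _ ≤ N (k + i) := pow_mul_le_of_lacunary (zero_le_one.trans hρ) hlac k i

/-- Ratio-`2` consequence of ratio-`ρ` lacunarity for `ρ ≥ 2`. [folklore] -/
theorem two_mul_le_of_lacunary (hN : ∀ k, 0 ≤ N k) (hρ : 2 ≤ ρ)
    (hlac : ∀ k, ρ * N k ≤ N (k + 1)) (k : ℕ) : 2 * N k ≤ N (k + 1) :=
  (mul_le_mul_of_nonneg_right hρ (hN k)).trans (hlac k)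

/-- A finite geometric sum with ratio `q ∈ [0,1)` over ANY finite set of exponents is at most
`1/(1-q)`. [folklore] -/
theorem sum_pow_le_one_div_one_sub (T : Finset ℕ) {q : ℝ} (hq0 : 0 ≤ q) (hq1 : q < 1) :
    ∑ i ∈ T, q ^ i ≤ 1 / (1 - q) := by
  calc ∑ i ∈ T, q ^ i ≤ ∑ i ∈ Finset.range (T.sup id + 1), q ^ i := by
        apply Finset.sum_le_sum_of_subset_of_nonneg
        · intro i hi
          have : i ≤ T.sup id := Finset.le_sup (f := id) hi
          simp only [Finset.mem_range]
          omega
        · intro i _ _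
          positivity
    _ ≤ 1 / (1 - q) := by
        have h := geom_sum_Ico_le_of_lt_one hq0 hq1 (m := 0) (n := T.sup id + 1)
        rwa [pow_zero, ← Finset.range_eq_Ico] at h

/-- Geometric sum anchored at an upper index: if every `k ∈ A` satisfies `k ≤ M` then
`∑_{k ∈ A} q^{M-k} ≤ 1/(1-q)`. [folklore] -/
theorem sum_pow_sub_le_of_forall_le {A : Finset ℕ} {M : ℕ} (hA : ∀ k ∈ A, k ≤ M) {q : ℝ}
    (hq0 : 0 ≤ q) (hq1 : q < 1) : ∑ k ∈ A, q ^ (M - k) ≤ 1 / (1 - q) := by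
  calc ∑ k ∈ A, q ^ (M - k) = ∑ i ∈ A.image (fun k => M - k), q ^ i := by
        rw [Finset.sum_image]
        intro k hk k' hk' h
        have h1 := hA k hk
        have h2 := hA k' hk'
        simp only at h
        omega
    _ ≤ 1 / (1 - q) := sum_pow_le_one_div_one_sub _ hq0 hq1

/-- Geometric sum anchored at a lower index: if every `k ∈ A` satisfies `m ≤ k` then
`∑_{k ∈ A} q^{k-m} ≤ 1/(1-q)`. [folklore] -/
theorem sum_pow_sub_le_of_forall_ge {A : Finset ℕ} {m : ℕ} (hA : ∀ k ∈ A, m ≤ k) {q : ℝ}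
    (hq0 : 0 ≤ q) (hq1 : q < 1) : ∑ k ∈ A, q ^ (k - m) ≤ 1 / (1 - q) := by
  calc ∑ k ∈ A, q ^ (k - m) = ∑ i ∈ A.image (fun k => k - m), q ^ i := by
        rw [Finset.sum_image]
        intro k hk k' hk' h
        have h1 := hA k hk
        have h2 := hA k' hk'
        simp only at h
        omega
    _ ≤ 1 / (1 - q) := sum_pow_le_one_div_one_sub _ hq0 hq1

/-- **A lacunary sequence below a threshold sums like a geometric series**: if `x` is positive
with `x_{k+1} ≥ 2 x_k`, then `∑_{k < n, x_k ≤ X} x_k ≤ 2X` (anchor at the largest such `k`: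
the others are `≤ X 2^{-(k_* - k)}`). [folklore] -/
theorem sum_filter_le_le_two_mul_of_lacunary {x : ℕ → ℝ}
    (hlac : ∀ k, 2 * x k ≤ x (k + 1)) {X : ℝ} (hX : 0 ≤ X) (n : ℕ) :
    ∑ k ∈ (Finset.range n).filter (fun k => x k ≤ X), x k ≤ 2 * X := by
  classical
  set A := (Finset.range n).filter (fun k => x k ≤ X) with hA
  rcases A.eq_empty_or_nonempty with hE | hne
  · rw [hE, Finset.sum_empty]
    positivity
  · set M := A.max' hne with hM
    have hMA : M ∈ A := Finset.max'_mem A hne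
    have hxM : x M ≤ X := (Finset.mem_filter.1 hMA).2
    have hterm : ∀ k ∈ A, x k ≤ X * (1 / 2 : ℝ) ^ (M - k) := by
      intro k hk
      have hkM : k ≤ M := Finset.le_max' A k hk
      have h1 : (2 : ℝ) ^ (M - k) * x k ≤ x (k + (M - k)) :=
        pow_mul_le_of_lacunary (by norm_num) hlac k (M - k)
      rw [Nat.add_sub_cancel' hkM] at h1
      have h2 : (2 : ℝ) ^ (M - k) * x k ≤ X := h1.trans hxM
      have h3 : 0 < (2 : ℝ) ^ (M - k) := by positivity
      rw [one_div_pow, mul_one_div, le_div_iff₀ h3, mul_comm]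
      exact h2
    calc ∑ k ∈ A, x k ≤ ∑ k ∈ A, X * (1 / 2 : ℝ) ^ (M - k) := Finset.sum_le_sum hterm
      _ = X * ∑ k ∈ A, (1 / 2 : ℝ) ^ (M - k) := by rw [Finset.mul_sum]
      _ ≤ X * (1 / (1 - 1 / 2)) :=
          mul_le_mul_of_nonneg_left (sum_pow_sub_le_of_forall_le
            (fun k hk => Finset.le_max' A k hk) (by norm_num) (by norm_num)) hX
      _ = 2 * X := by ring

end Lacunary

/-! ## The Gaussian profile: `x^a e^{-x²} ≤ C_a e^{-x²/2}` for `x ≥ 1`, and `4^i ≥ i + 1` -/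

section Profile

/-- `x^a e^{-x²} ≤ 2^m m! e^{-x²/2}` for `x ≥ 1`, `a ∈ ℝ`, `m = ⌈a/2⌉₊` (from `x^a ≤ x^{2m}` and
`y^m/m! ≤ e^y` at `y = x²/2`). [folklore] -/
theorem rpow_mul_exp_neg_sq_le {x a : ℝ} (hx : 1 ≤ x) :
    x ^ a * Real.exp (-x ^ 2) ≤
      (2 : ℝ) ^ ⌈a / 2⌉₊ * (⌈a / 2⌉₊).factorial * Real.exp (-(x ^ 2 / 2)) := by
  set m : ℕ := ⌈a / 2⌉₊ with hm
  have hx0 : 0 < x := one_pos.trans_le hx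
  have hy : 0 ≤ x ^ 2 / 2 := by positivity
  have ham : a ≤ ((2 * m : ℕ) : ℝ) := by
    have h := Nat.le_ceil (a / 2)
    rw [← hm] at h
    push_cast
    linarith
  -- `x^a ≤ (x²)^m`
  have h1 : x ^ a ≤ (x ^ 2) ^ m := by
    calc x ^ a ≤ x ^ ((2 * m : ℕ) : ℝ) := Real.rpow_le_rpow_of_exponent_le hx ham
      _ = (x ^ 2) ^ m := by rw [Real.rpow_natCast, pow_mul]
  -- `(x²/2)^m ≤ m! e^{x²/2}`
  have h2 : (x ^ 2 / 2) ^ m ≤ m.factorial * Real.exp (x ^ 2 / 2) := by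
    have h := Real.pow_div_factorial_le_exp (x ^ 2 / 2) hy m
    rw [div_le_iff₀ (by positivity)] at h
    linarith [mul_comm (Real.exp (x ^ 2 / 2)) (m.factorial : ℝ)]
  have h3 : (x ^ 2) ^ m = (2 : ℝ) ^ m * (x ^ 2 / 2) ^ m := by
    rw [← mul_pow]
    congr 1
    ring
  calc x ^ a * Real.exp (-x ^ 2) ≤ (x ^ 2) ^ m * Real.exp (-x ^ 2) :=
        mul_le_mul_of_nonneg_right h1 (Real.exp_pos _).le
    _ = (2 : ℝ) ^ m * (x ^ 2 / 2) ^ m * Real.exp (-x ^ 2) := by rw [h3]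
    _ ≤ (2 : ℝ) ^ m * (m.factorial * Real.exp (x ^ 2 / 2)) * Real.exp (-x ^ 2) := by
        gcongr
    _ = (2 : ℝ) ^ m * m.factorial * (Real.exp (x ^ 2 / 2) * Real.exp (-x ^ 2)) := by ring
    _ = (2 : ℝ) ^ m * m.factorial * Real.exp (-(x ^ 2 / 2)) := by
        rw [← Real.exp_add]
        congr 1
        ring_nf

/-- `i + 1 ≤ 4^i` (Bernoulli). [folklore] -/
theorem cast_add_one_le_four_pow (i : ℕ) : (i : ℝ) + 1 ≤ (4 : ℝ) ^ i := by
  have h := one_add_mul_le_pow (show (-2 : ℝ) ≤ 3 by norm_num) i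
  have h4 : (1 : ℝ) + 3 = 4 := by norm_num
  rw [h4] at h
  have hi : (0 : ℝ) ≤ i := Nat.cast_nonneg i
  linarith

/-- `e^{-κ 4^i} ≤ (e^{-κ})^{i+1}` for `κ ≥ 0`. [folklore] -/
theorem exp_neg_mul_four_pow_le {κ : ℝ} (hκ : 0 ≤ κ) (i : ℕ) :
    Real.exp (-(κ * (4 : ℝ) ^ i)) ≤ Real.exp (-κ) ^ (i + 1) := by
  rw [← Real.exp_nat_mul, Real.exp_le_exp]
  have h := cast_add_one_le_four_pow i
  have : ((i + 1 : ℕ) : ℝ) * -κ = -(κ * ((i : ℝ) + 1)) := by push_cast; ring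
  rw [this, neg_le_neg_iff]
  exact mul_le_mul_of_nonneg_left h hκ

/-- `e^{-κ}/(1 - e^{-κ}) ≤ 1/κ` for `κ > 0` (`e^κ - 1 ≥ κ`). [folklore] -/
theorem exp_neg_div_one_sub_exp_neg_le {κ : ℝ} (hκ : 0 < κ) :
    Real.exp (-κ) / (1 - Real.exp (-κ)) ≤ 1 / κ := by
  have h1 : Real.exp (-κ) < 1 := Real.exp_lt_one_iff.2 (neg_neg_of_pos hκ)
  have h2 : 0 < 1 - Real.exp (-κ) := by linarith
  rw [div_le_div_iff₀ h2 hκ, one_mul]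
  -- `κ e^{-κ} ≤ 1 - e^{-κ}` ⟸ `κ + 1 ≤ e^{κ}` (multiply by `e^{-κ}`)
  have h3 : κ + 1 ≤ Real.exp κ := by linarith [Real.add_one_le_exp κ]
  have h4 : Real.exp (-κ) * Real.exp κ = 1 := by rw [← Real.exp_add]; simp
  have h5 : 0 < Real.exp (-κ) := Real.exp_pos _
  nlinarith [mul_le_mul_of_nonneg_left h3 h5.le]

end Profile

/-! ## (3.13a), summed: `∑ₖ N_k^a e^{-c N_k² t} ≲ t^{-a/2}` -/

section GaussianSum

variable {N : ℕ → ℝ}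

/-- **Normalised lacunary Gaussian sum.** For a positive sequence with `x_{k+1} ≥ 2 x_k` and
`a > 0`: `∑_{k<n} x_k^a e^{-x_k²} ≤ 1/(1 - 2^{-a}) + 2·2^m m!`, `m = ⌈a/2⌉₊`, uniformly in `n`
(terms with `x_k ≤ 1`: `x_k^a ≤ 2^{-a(k_*-k)}`; terms with `x_k > 1`: `x_k ≥ 2^{k-k₀}`, so
`e^{-x_k²/2} ≤ e^{-4^{k-k₀}/2} ≤ e^{-(k-k₀+1)/2}`). [folklore] -/
theorem sum_rpow_mul_exp_neg_sq_le_of_lacunary {x : ℕ → ℝ} (hx : ∀ k, 0 < x k)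
    (hlac : ∀ k, 2 * x k ≤ x (k + 1)) {a : ℝ} (ha : 0 < a) (n : ℕ) :
    ∑ k ∈ Finset.range n, x k ^ a * Real.exp (-x k ^ 2) ≤
      1 / (1 - (1 / 2 : ℝ) ^ a) + 2 * ((2 : ℝ) ^ ⌈a / 2⌉₊ * (⌈a / 2⌉₊).factorial) := by
  classical
  set Ca : ℝ := (2 : ℝ) ^ ⌈a / 2⌉₊ * (⌈a / 2⌉₊).factorial with hCa
  have hCa0 : 0 ≤ Ca := by positivity
  set q : ℝ := (1 / 2 : ℝ) ^ a with hq
  have hq0 : 0 ≤ q := Real.rpow_nonneg (by norm_num) _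
  have hq1 : q < 1 := Real.rpow_lt_one (by norm_num) (by norm_num) ha
  set f : ℕ → ℝ := fun k => x k ^ a * Real.exp (-x k ^ 2) with hf
  rw [← Finset.sum_filter_add_sum_filter_not (Finset.range n) (fun k => x k ≤ 1) f]
  -- Part 1: the terms with `x_k ≤ 1`
  have hP1 : ∑ k ∈ (Finset.range n).filter (fun k => x k ≤ 1), f k ≤ 1 / (1 - q) := by
    set A := (Finset.range n).filter (fun k => x k ≤ 1) with hA
    rcases A.eq_empty_or_nonempty with hE | hne
    · rw [hE, Finset.sum_empty]
      exact div_nonneg zero_le_one (by linarith)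
    · set M := A.max' hne with hM
      have hMA : M ∈ A := Finset.max'_mem A hne
      have hxM : x M ≤ 1 := (Finset.mem_filter.1 hMA).2
      have hterm : ∀ k ∈ A, f k ≤ q ^ (M - k) := by
        intro k hk
        have hkM : k ≤ M := Finset.le_max' A k hk
        have h1 : (2 : ℝ) ^ (M - k) * x k ≤ x (k + (M - k)) :=
          pow_mul_le_of_lacunary (by norm_num) hlac k (M - k)
        rw [Nat.add_sub_cancel' hkM] at h1
        have h2 : (2 : ℝ) ^ (M - k) * x k ≤ 1 := h1.trans hxM
        have h3 : 0 < (2 : ℝ) ^ (M - k) := by positivity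
        have hxle : x k ≤ (1 / 2 : ℝ) ^ (M - k) := by
          rw [one_div_pow, le_div_iff₀ h3, mul_comm]
          exact h2
        have hexp : Real.exp (-x k ^ 2) ≤ 1 := by
          rw [Real.exp_le_one_iff, neg_nonpos]
          positivity
        calc f k = x k ^ a * Real.exp (-x k ^ 2) := rfl
          _ ≤ ((1 / 2 : ℝ) ^ (M - k)) ^ a * 1 := by
              gcongr
              exact (hx k).le
          _ = q ^ (M - k) := by
              rw [mul_one, hq, ← Real.rpow_natCast, ← Real.rpow_mul (by norm_num), mul_comm,
                Real.rpow_mul (by norm_num), Real.rpow_natCast]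
      calc ∑ k ∈ A, f k ≤ ∑ k ∈ A, q ^ (M - k) := Finset.sum_le_sum hterm
        _ ≤ 1 / (1 - q) :=
            sum_pow_sub_le_of_forall_le (fun k hk => Finset.le_max' A k hk) hq0 hq1
  -- Part 2: the terms with `x_k > 1`
  have hP2 : ∑ k ∈ (Finset.range n).filter (fun k => ¬x k ≤ 1), f k ≤ 2 * Ca := by
    set B := (Finset.range n).filter (fun k => ¬x k ≤ 1) with hB
    rcases B.eq_empty_or_nonempty with hE | hne
    · rw [hE, Finset.sum_empty]
      positivity
    · set m₀ := B.min' hne with hm₀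
      have hm₀B : m₀ ∈ B := Finset.min'_mem B hne
      have hxm₀ : 1 < x m₀ := not_le.1 (Finset.mem_filter.1 hm₀B).2
      set r : ℝ := Real.exp (-(1 / 2 : ℝ)) with hr
      have hr0 : 0 ≤ r := (Real.exp_pos _).le
      have hr1 : r < 1 := Real.exp_lt_one_iff.2 (by norm_num)
      -- `r/(1-r) ≤ 2`
      have hr2 : r / (1 - r) ≤ 2 := by
        have h := exp_neg_div_one_sub_exp_neg_le (κ := 1 / 2) (by norm_num)
        rw [← hr] at h
        linarith [show (1 : ℝ) / (1 / 2) = 2 by norm_num]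
      have hterm : ∀ k ∈ B, f k ≤ Ca * (r * r ^ (k - m₀)) := by
        intro k hk
        have hmk : m₀ ≤ k := Finset.min'_le B k hk
        have hxk1 : 1 < x k := not_le.1 (Finset.mem_filter.1 hk).2
        -- `x_k ≥ 2^{k-m₀}`
        have h1 : (2 : ℝ) ^ (k - m₀) * x m₀ ≤ x (m₀ + (k - m₀)) :=
          pow_mul_le_of_lacunary (by norm_num) hlac m₀ (k - m₀)
        rw [Nat.add_sub_cancel' hmk] at h1
        have h2 : (2 : ℝ) ^ (k - m₀) ≤ x k := by
          have h3 : (2 : ℝ) ^ (k - m₀) * 1 ≤ (2 : ℝ) ^ (k - m₀) * x m₀ :=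
            mul_le_mul_of_nonneg_left hxm₀.le (by positivity)
          linarith
        -- `e^{-x_k²/2} ≤ e^{-4^{k-m₀}/2} ≤ r^{k-m₀+1}`
        have h4 : Real.exp (-(x k ^ 2 / 2)) ≤ r ^ (k - m₀ + 1) := by
          have h5 : (4 : ℝ) ^ (k - m₀) ≤ x k ^ 2 := by
            have : (4 : ℝ) ^ (k - m₀) = ((2 : ℝ) ^ (k - m₀)) ^ 2 := by
              rw [← pow_mul, mul_comm, pow_mul]
              norm_num
            rw [this]
            exact pow_le_pow_left₀ (by positivity) h2 2
          calc Real.exp (-(x k ^ 2 / 2)) ≤ Real.exp (-((1 / 2 : ℝ) * (4 : ℝ) ^ (k - m₀))) := by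
                rw [Real.exp_le_exp]
                linarith
            _ ≤ r ^ (k - m₀ + 1) := exp_neg_mul_four_pow_le (by norm_num) (k - m₀)
        calc f k = x k ^ a * Real.exp (-x k ^ 2) := rfl
          _ ≤ Ca * Real.exp (-(x k ^ 2 / 2)) := rpow_mul_exp_neg_sq_le hxk1.le
          _ ≤ Ca * r ^ (k - m₀ + 1) := mul_le_mul_of_nonneg_left h4 hCa0
          _ = Ca * (r * r ^ (k - m₀)) := by rw [pow_succ']
      calc ∑ k ∈ B, f k ≤ ∑ k ∈ B, Ca * (r * r ^ (k - m₀)) := Finset.sum_le_sum hterm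
        _ = Ca * (r * ∑ k ∈ B, r ^ (k - m₀)) := by
            rw [Finset.mul_sum, Finset.mul_sum]
        _ ≤ Ca * (r * (1 / (1 - r))) := by
            gcongr
            exact sum_pow_sub_le_of_forall_ge (fun k hk => Finset.min'_le B k hk) hr0 hr1
        _ = Ca * (r / (1 - r)) := by ring
        _ ≤ Ca * 2 := mul_le_mul_of_nonneg_left hr2 hCa0
        _ = 2 * Ca := mul_comm _ _
  linarith

/-- **(3.13a), summed — scaled form.** For a positive sequence of scales with
`N_{k+1} ≥ 2 N_k`, `a > 0`, `c > 0`, `t > 0`: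
`∑_{k<n} N_k^a e^{-c N_k² t} ≤ C_a (c t)^{-a/2}` with `C_a = 1/(1-2^{-a}) + 2·2^m m!`, `m = ⌈a/2⌉₊`,
uniformly in `n` (apply the normalised bound to `x_k = N_k √(ct)`).
[cite: CoiculescuPalasek2025, proof of Prop. 3.13 (vweightedlinftybound)] -/
theorem sum_rpow_mul_exp_neg_le_of_lacunary (hN : ∀ k, 0 < N k)
    (hlac : ∀ k, 2 * N k ≤ N (k + 1)) {a : ℝ} (ha : 0 < a) {c t : ℝ} (hc : 0 < c)
    (ht : 0 < t) (n : ℕ) :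
    ∑ k ∈ Finset.range n, N k ^ a * Real.exp (-(c * N k ^ 2 * t)) ≤
      (1 / (1 - (1 / 2 : ℝ) ^ a) + 2 * ((2 : ℝ) ^ ⌈a / 2⌉₊ * (⌈a / 2⌉₊).factorial)) *
        (c * t) ^ (-(a / 2)) := by
  have hct : 0 < c * t := mul_pos hc ht
  set s : ℝ := Real.sqrt (c * t) with hs
  have hs0 : 0 < s := Real.sqrt_pos.2 hct
  have hs2 : s ^ 2 = c * t := Real.sq_sqrt hct.le
  set x : ℕ → ℝ := fun k => N k * s with hx
  have hx0 : ∀ k, 0 < x k := fun k => mul_pos (hN k) hs0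
  have hxlac : ∀ k, 2 * x k ≤ x (k + 1) := fun k => by
    simp only [hx]
    rw [← mul_assoc]
    exact mul_le_mul_of_nonneg_right (hlac k) hs0.le
  have hmain := sum_rpow_mul_exp_neg_sq_le_of_lacunary hx0 hxlac ha n
  -- termwise identity `N_k^a e^{-cN_k²t} = (ct)^{-a/2} · x_k^a e^{-x_k²}`
  have hsa : s ^ a = (c * t) ^ (a / 2) := by
    rw [hs, Real.sqrt_eq_rpow, ← Real.rpow_mul hct.le]
    congr 1
    ring
  have hterm : ∀ k, N k ^ a * Real.exp (-(c * N k ^ 2 * t)) =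
      (c * t) ^ (-(a / 2)) * (x k ^ a * Real.exp (-x k ^ 2)) := by
    intro k
    have h1 : x k ^ a = N k ^ a * (c * t) ^ (a / 2) := by
      simp only [hx]
      rw [Real.mul_rpow (hN k).le hs0.le, hsa]
    have h2 : x k ^ 2 = c * N k ^ 2 * t := by
      simp only [hx]
      rw [mul_pow, hs2]
      ring
    rw [h1, h2, Real.rpow_neg hct.le]
    have h3 : (c * t) ^ (a / 2) ≠ 0 := (Real.rpow_pos_of_pos hct _).ne'
    field_simp
  calc ∑ k ∈ Finset.range n, N k ^ a * Real.exp (-(c * N k ^ 2 * t))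
      = (c * t) ^ (-(a / 2)) * ∑ k ∈ Finset.range n, x k ^ a * Real.exp (-x k ^ 2) := by
        rw [Finset.mul_sum]
        exact Finset.sum_congr rfl fun k _ => hterm k
    _ ≤ (c * t) ^ (-(a / 2)) *
          (1 / (1 - (1 / 2 : ℝ) ^ a) + 2 * ((2 : ℝ) ^ ⌈a / 2⌉₊ * (⌈a / 2⌉₊).factorial)) :=
        mul_le_mul_of_nonneg_left hmain (Real.rpow_nonneg hct.le _)
    _ = _ := mul_comm _ _

/-- **(3.13a), summed**: for `a, c > 0` there is `C` (depending on `a, c` only) such that for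
EVERY positive sequence of scales with `N_{k+1} ≥ 2N_k`, every `t > 0` and every `n`,
`∑_{k<n} N_k^a e^{-c N_k² t} ≤ C t^{-a/2}`. With the block bounds
`‖∇^m v_k(t)‖_∞ ≲ N_k^{1+m} e^{-N_k² t}` this is
`‖∇^m v(t)‖_∞ ≲_m t^{-(m+1)/2}`. [cite: CoiculescuPalasek2025, Prop. 3.13 (vweightedlinftybound) and its proof] -/
theorem exists_sum_rpow_mul_exp_neg_le_of_lacunary {a c : ℝ} (ha : 0 < a) (hc : 0 < c) :
    ∃ C : ℝ, 0 < C ∧ ∀ N : ℕ → ℝ, (∀ k, 0 < N k) → (∀ k, 2 * N k ≤ N (k + 1)) →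
      ∀ t : ℝ, 0 < t → ∀ n : ℕ,
        ∑ k ∈ Finset.range n, N k ^ a * Real.exp (-(c * N k ^ 2 * t)) ≤ C * t ^ (-(a / 2)) := by
  set Ca : ℝ := 1 / (1 - (1 / 2 : ℝ) ^ a) + 2 * ((2 : ℝ) ^ ⌈a / 2⌉₊ * (⌈a / 2⌉₊).factorial)
    with hCa
  have hq1 : (1 / 2 : ℝ) ^ a < 1 := Real.rpow_lt_one (by norm_num) (by norm_num) ha
  have hCa0 : 0 < Ca := by
    have h1 : 0 < 1 / (1 - (1 / 2 : ℝ) ^ a) := div_pos one_pos (by linarith)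
    positivity
  refine ⟨Ca * c ^ (-(a / 2)), by positivity, fun N hN hlac t ht n => ?_⟩
  have h := sum_rpow_mul_exp_neg_le_of_lacunary hN hlac ha hc ht n
  rw [Real.mul_rpow hc.le ht.le, ← mul_assoc] at h
  exact h

/-- **(3.13a) with the exponential factor**: under the same hypotheses,
`∑_{k<n} N_k^a e^{-c N_k² t} ≤ C t^{-a/2} e^{-c N₀² t/2}` (split `e^{-cN_k²t} = e^{-cN_k²t/2}·e^{-cN_k²t/2}`
and use `N_k ≥ N₀`): the factor `e^{-N₀² t/O_m(1)}` of (3.13a).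
[cite: CoiculescuPalasek2025, Prop. 3.13 (vweightedlinftybound)] -/
theorem exists_sum_rpow_mul_exp_neg_le_exp_of_lacunary {a c : ℝ} (ha : 0 < a) (hc : 0 < c) :
    ∃ C : ℝ, 0 < C ∧ ∀ N : ℕ → ℝ, (∀ k, 0 < N k) → (∀ k, 2 * N k ≤ N (k + 1)) →
      ∀ t : ℝ, 0 < t → ∀ n : ℕ,
        ∑ k ∈ Finset.range n, N k ^ a * Real.exp (-(c * N k ^ 2 * t)) ≤
          C * t ^ (-(a / 2)) * Real.exp (-(c / 2 * N 0 ^ 2 * t)) := by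
  obtain ⟨C, hC0, hC⟩ := exists_sum_rpow_mul_exp_neg_le_of_lacunary ha (half_pos hc)
  refine ⟨C, hC0, fun N hN hlac t ht n => ?_⟩
  have hmono : ∀ k, N 0 ≤ N k := fun k =>
    le_of_lacunary (fun k => (hN k).le) (by norm_num : (1 : ℝ) ≤ 2) hlac (Nat.zero_le k)
  have hterm : ∀ k ∈ Finset.range n, N k ^ a * Real.exp (-(c * N k ^ 2 * t)) ≤
      N k ^ a * Real.exp (-(c / 2 * N k ^ 2 * t)) * Real.exp (-(c / 2 * N 0 ^ 2 * t)) := by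
    intro k _
    have h1 : N 0 ^ 2 ≤ N k ^ 2 := pow_le_pow_left₀ (hN 0).le (hmono k) 2
    have h2 : c / 2 * N 0 ^ 2 * t ≤ c / 2 * N k ^ 2 * t :=
      mul_le_mul_of_nonneg_right (mul_le_mul_of_nonneg_left h1 (half_pos hc).le) ht.le
    calc N k ^ a * Real.exp (-(c * N k ^ 2 * t))
        ≤ N k ^ a * Real.exp (-(c / 2 * N k ^ 2 * t) + -(c / 2 * N 0 ^ 2 * t)) := by
          refine mul_le_mul_of_nonneg_left (Real.exp_le_exp.2 ?_) (Real.rpow_nonneg (hN k).le _)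
          nlinarith
      _ = N k ^ a * Real.exp (-(c / 2 * N k ^ 2 * t)) * Real.exp (-(c / 2 * N 0 ^ 2 * t)) := by
          rw [Real.exp_add]
          ring
  calc ∑ k ∈ Finset.range n, N k ^ a * Real.exp (-(c * N k ^ 2 * t))
      ≤ ∑ k ∈ Finset.range n,
          N k ^ a * Real.exp (-(c / 2 * N k ^ 2 * t)) * Real.exp (-(c / 2 * N 0 ^ 2 * t)) :=
        Finset.sum_le_sum hterm
    _ = (∑ k ∈ Finset.range n, N k ^ a * Real.exp (-(c / 2 * N k ^ 2 * t))) *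
          Real.exp (-(c / 2 * N 0 ^ 2 * t)) := by rw [Finset.sum_mul]
    _ ≤ C * t ^ (-(a / 2)) * Real.exp (-(c / 2 * N 0 ^ 2 * t)) :=
        mul_le_mul_of_nonneg_right (hC N hN hlac t ht n) (Real.exp_pos _).le

/-- The series `∑ₖ N_k^a e^{-c N_k² t}` of a lacunary sequence of scales converges for `t > 0`.
[folklore] -/
theorem summable_rpow_mul_exp_neg_of_lacunary (hN : ∀ k, 0 < N k)
    (hlac : ∀ k, 2 * N k ≤ N (k + 1)) {a : ℝ} (ha : 0 < a) {c t : ℝ} (hc : 0 < c)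
    (ht : 0 < t) : Summable fun k => N k ^ a * Real.exp (-(c * N k ^ 2 * t)) :=
  summable_of_sum_range_le (fun k => by have := hN k; positivity)
    (sum_rpow_mul_exp_neg_le_of_lacunary hN hlac ha hc ht)

/-- **(3.13a), summed over all scales**: `∑'ₖ N_k^a e^{-c N_k² t} ≤ C t^{-a/2} e^{-cN₀²t/2}`, with
`C = C(a,c)` uniform over positive sequences with `N_{k+1} ≥ 2N_k` and over `t > 0`.
[cite: CoiculescuPalasek2025, Prop. 3.13 (vweightedlinftybound)] -/
theorem exists_tsum_rpow_mul_exp_neg_le_of_lacunary {a c : ℝ} (ha : 0 < a) (hc : 0 < c) :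
    ∃ C : ℝ, 0 < C ∧ ∀ N : ℕ → ℝ, (∀ k, 0 < N k) → (∀ k, 2 * N k ≤ N (k + 1)) →
      ∀ t : ℝ, 0 < t →
        ∑' k, N k ^ a * Real.exp (-(c * N k ^ 2 * t)) ≤
          C * t ^ (-(a / 2)) * Real.exp (-(c / 2 * N 0 ^ 2 * t)) := by
  obtain ⟨C, hC0, hC⟩ := exists_sum_rpow_mul_exp_neg_le_exp_of_lacunary ha hc
  exact ⟨C, hC0, fun N hN hlac t ht =>
    Real.tsum_le_of_sum_range_le (fun k => by have := hN k; positivity) (hC N hN hlac t ht)⟩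

end GaussianSum

/-! ## Counting scales in a window: `#{k : L ≤ N_k ≤ U} ≤ 1 + log(U/L)/log ρ` -/

section Counting

variable {N : ℕ → ℝ} {ρ : ℝ}

/-- **Lacunary sequences visit a window `[L, U]` at most `1 + log(U/L)/log ρ` times**
(`0 < L ≤ U`, ratio `ρ > 1`): two visiting indices `k₁ ≤ k₂` satisfy `ρ^{k₂-k₁} L ≤ U`.
[cite: CoiculescuPalasek2025, proof of Prop. 3.13, term I ("`N_k` is more lacunary than the geometric sequence")] -/
theorem card_filter_mem_Icc_le_of_lacunary (hρ : 1 < ρ)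
    (hlac : ∀ k, ρ * N k ≤ N (k + 1)) {L U : ℝ} (hL : 0 < L) (hLU : L ≤ U) (n : ℕ) :
    ((((Finset.range n).filter fun k => L ≤ N k ∧ N k ≤ U).card : ℕ) : ℝ) ≤
      1 + Real.log (U / L) / Real.log ρ := by
  classical
  have hlogρ : 0 < Real.log ρ := Real.log_pos hρ
  have hlog0 : 0 ≤ Real.log (U / L) := Real.log_nonneg ((one_le_div hL).2 hLU)
  set A := (Finset.range n).filter (fun k => L ≤ N k ∧ N k ≤ U) with hA
  rcases A.eq_empty_or_nonempty with hE | hne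
  · rw [hE, Finset.card_empty, Nat.cast_zero]
    positivity
  · set k₁ := A.min' hne with hk₁
    set k₂ := A.max' hne with hk₂
    have hk₁A : k₁ ∈ A := Finset.min'_mem A hne
    have hk₂A : k₂ ∈ A := Finset.max'_mem A hne
    have hL₁ : L ≤ N k₁ := (Finset.mem_filter.1 hk₁A).2.1
    have hU₂ : N k₂ ≤ U := (Finset.mem_filter.1 hk₂A).2.2
    have h12 : k₁ ≤ k₂ := Finset.min'_le A k₂ hk₂A
    -- `A ⊆ [k₁, k₂]`, so `#A ≤ k₂ - k₁ + 1`
    have hcard : A.card ≤ k₂ - k₁ + 1 := by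
      calc A.card ≤ (Finset.Icc k₁ k₂).card := by
            refine Finset.card_le_card fun k hk => ?_
            rw [Finset.mem_Icc]
            exact ⟨Finset.min'_le A k hk, Finset.le_max' A k hk⟩
        _ = k₂ + 1 - k₁ := Nat.card_Icc k₁ k₂
        _ = k₂ - k₁ + 1 := by omega
    -- `ρ^{k₂-k₁} ≤ U/L`
    have hpow : ρ ^ (k₂ - k₁) ≤ U / L := by
      have h1 : ρ ^ (k₂ - k₁) * N k₁ ≤ N (k₁ + (k₂ - k₁)) :=
        pow_mul_le_of_lacunary (zero_le_one.trans hρ.le) hlac k₁ (k₂ - k₁)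
      rw [Nat.add_sub_cancel' h12] at h1
      rw [le_div_iff₀ hL]
      calc ρ ^ (k₂ - k₁) * L ≤ ρ ^ (k₂ - k₁) * N k₁ :=
            mul_le_mul_of_nonneg_left hL₁ (by positivity)
        _ ≤ N k₂ := h1
        _ ≤ U := hU₂
    have hdiff : ((k₂ - k₁ : ℕ) : ℝ) ≤ Real.log (U / L) / Real.log ρ := by
      rw [le_div_iff₀ hlogρ, ← Real.log_pow]
      exact Real.log_le_log (by positivity) hpow
    calc ((A.card : ℕ) : ℝ) ≤ ((k₂ - k₁ + 1 : ℕ) : ℝ) := by exact_mod_cast hcard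
      _ = ((k₂ - k₁ : ℕ) : ℝ) + 1 := by push_cast; ring
      _ ≤ Real.log (U / L) / Real.log ρ + 1 := by linarith
      _ = 1 + Real.log (U / L) / Real.log ρ := add_comm _ _

end Counting

/-! ## (3.13b): the weighted `L¹` bound `∫ t^{-1/2} ∑ₖ N_k e^{-c N_k² t} dt ≲ 1 + log(t₂/t₁)/log ρ` -/

section WeightedL1

/-- The single-scale integrand `t ↦ t^{-1/2} M e^{-c M² t}` is continuous on `[t₁, t₂] ⊂ (0, ∞)`,
hence interval integrable. [folklore] -/
theorem intervalIntegrable_rpow_neg_half_mul_exp {M c t₁ t₂ : ℝ} (ht₁ : 0 < t₁) (h12 : t₁ ≤ t₂) :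
    IntervalIntegrable (fun t => t ^ (-(1 / 2 : ℝ)) * (M * Real.exp (-(c * M ^ 2 * t))))
      volume t₁ t₂ := by
  refine (ContinuousOn.mul ?_ ?_).intervalIntegrable_of_Icc h12
  · exact ContinuousOn.rpow_const continuousOn_id fun t ht => Or.inl (ht₁.trans_le ht.1).ne'
  · exact (continuous_const.mul (Real.continuous_exp.comp
      ((continuous_const.mul continuous_id).neg))).continuousOn

/-- **Scale below the window**: `∫_{t₁}^{t₂} t^{-1/2} M e^{-cM²t} dt ≤ 2 M √t₂` (drop the exponential,
`∫_{t₁}^{t₂} t^{-1/2} dt = 2(√t₂ - √t₁)`). [cite: CoiculescuPalasek2025, proof of Prop. 3.13, term I] -/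
theorem integral_rpow_neg_half_mul_exp_le_sqrt {M c t₁ t₂ : ℝ} (hM : 0 ≤ M) (hc : 0 ≤ c)
    (ht₁ : 0 < t₁) (h12 : t₁ ≤ t₂) :
    ∫ t in t₁..t₂, t ^ (-(1 / 2 : ℝ)) * (M * Real.exp (-(c * M ^ 2 * t))) ≤
      2 * M * Real.sqrt t₂ := by
  have ht₂ : 0 < t₂ := ht₁.trans_le h12
  have hmono : ∫ t in t₁..t₂, t ^ (-(1 / 2 : ℝ)) * (M * Real.exp (-(c * M ^ 2 * t))) ≤
      ∫ t in t₁..t₂, M * t ^ (-(1 / 2 : ℝ)) := by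
    refine intervalIntegral.integral_mono_on h12
      (intervalIntegrable_rpow_neg_half_mul_exp ht₁ h12) ?_ fun t ht => ?_
    · exact ((continuousOn_const.mul (ContinuousOn.rpow_const continuousOn_id fun t ht =>
        Or.inl (ht₁.trans_le ht.1).ne'))).intervalIntegrable_of_Icc h12
    · have ht0 : 0 < t := ht₁.trans_le ht.1
      have hexp : Real.exp (-(c * M ^ 2 * t)) ≤ 1 := by
        rw [Real.exp_le_one_iff, neg_nonpos]
        positivity
      have hr : 0 ≤ t ^ (-(1 / 2 : ℝ)) := Real.rpow_nonneg ht0.le _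
      calc t ^ (-(1 / 2 : ℝ)) * (M * Real.exp (-(c * M ^ 2 * t)))
          ≤ t ^ (-(1 / 2 : ℝ)) * (M * 1) := by gcongr
        _ = M * t ^ (-(1 / 2 : ℝ)) := by ring
  have hint : ∫ t in t₁..t₂, M * t ^ (-(1 / 2 : ℝ)) = M * (2 * (Real.sqrt t₂ - Real.sqrt t₁)) := by
    rw [intervalIntegral.integral_const_mul, integral_rpow (Or.inl (by norm_num))]
    congr 1
    have h1 : (-(1 / 2 : ℝ)) + 1 = 1 / 2 := by norm_num
    rw [h1, Real.sqrt_eq_rpow, Real.sqrt_eq_rpow]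
    field_simp
  have hs₁ : 0 ≤ Real.sqrt t₁ := Real.sqrt_nonneg _
  calc ∫ t in t₁..t₂, t ^ (-(1 / 2 : ℝ)) * (M * Real.exp (-(c * M ^ 2 * t)))
      ≤ M * (2 * (Real.sqrt t₂ - Real.sqrt t₁)) := hmono.trans_eq hint
    _ ≤ 2 * M * Real.sqrt t₂ := by nlinarith

/-- **Scale above the window**: `∫_{t₁}^{t₂} t^{-1/2} M e^{-cM²t} dt ≤ e^{-cM²t₁}/(c M √t₁)`
(bound `t^{-1/2} ≤ t₁^{-1/2}` and integrate the exponential), `M, c > 0`.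
[cite: CoiculescuPalasek2025, proof of Prop. 3.13, term II] -/
theorem integral_rpow_neg_half_mul_exp_le_exp {M c t₁ t₂ : ℝ} (hM : 0 < M) (hc : 0 < c)
    (ht₁ : 0 < t₁) (h12 : t₁ ≤ t₂) :
    ∫ t in t₁..t₂, t ^ (-(1 / 2 : ℝ)) * (M * Real.exp (-(c * M ^ 2 * t))) ≤
      Real.exp (-(c * M ^ 2 * t₁)) / (c * M * Real.sqrt t₁) := by
  set κ : ℝ := c * M ^ 2 with hκ
  have hκ0 : 0 < κ := by positivity
  have hs₁ : 0 < Real.sqrt t₁ := Real.sqrt_pos.2 ht₁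
  have hrpow₁ : t₁ ^ (-(1 / 2 : ℝ)) = (Real.sqrt t₁)⁻¹ := by
    rw [Real.rpow_neg ht₁.le, Real.sqrt_eq_rpow]
  -- pointwise: `t^{-1/2} M e^{-κt} ≤ t₁^{-1/2} M e^{-κ t}`
  have hmono : ∫ t in t₁..t₂, t ^ (-(1 / 2 : ℝ)) * (M * Real.exp (-(c * M ^ 2 * t))) ≤
      ∫ t in t₁..t₂, (Real.sqrt t₁)⁻¹ * M * Real.exp (-κ * t) := by
    refine intervalIntegral.integral_mono_on h12
      (intervalIntegrable_rpow_neg_half_mul_exp ht₁ h12) ?_ fun t ht => ?_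
    · exact ((continuous_const.mul (Real.continuous_exp.comp
        (continuous_const.mul continuous_id))).continuousOn).intervalIntegrable_of_Icc h12
    · have ht0 : 0 < t := ht₁.trans_le ht.1
      have h1 : t ^ (-(1 / 2 : ℝ)) ≤ (Real.sqrt t₁)⁻¹ := by
        rw [← hrpow₁]
        exact Real.rpow_le_rpow_of_nonpos ht₁ ht.1 (by norm_num)
      have h2 : Real.exp (-(c * M ^ 2 * t)) = Real.exp (-κ * t) := by rw [hκ]; ring_nf
      rw [h2]
      have h3 : 0 ≤ M * Real.exp (-κ * t) := by positivity
      calc t ^ (-(1 / 2 : ℝ)) * (M * Real.exp (-κ * t)) ≤ (Real.sqrt t₁)⁻¹ * (M * Real.exp (-κ * t)) :=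
            mul_le_mul_of_nonneg_right h1 h3
        _ = (Real.sqrt t₁)⁻¹ * M * Real.exp (-κ * t) := by ring
  -- `∫_{t₁}^{t₂} e^{-κt} dt = (e^{-κt₁} - e^{-κt₂})/κ ≤ e^{-κt₁}/κ`
  have hexpint : ∫ t in t₁..t₂, Real.exp (-κ * t) = (Real.exp (-κ * t₁) - Real.exp (-κ * t₂)) / κ := by
    rw [intervalIntegral.integral_comp_mul_left (fun t => Real.exp t) (neg_ne_zero.2 hκ0.ne'),
      integral_exp]
    simp only [smul_eq_mul]
    field_simp
    ring
  have hint : ∫ t in t₁..t₂, (Real.sqrt t₁)⁻¹ * M * Real.exp (-κ * t) ≤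
      (Real.sqrt t₁)⁻¹ * M * (Real.exp (-κ * t₁) / κ) := by
    rw [intervalIntegral.integral_const_mul, hexpint]
    refine mul_le_mul_of_nonneg_left ?_ (by positivity)
    rw [div_le_div_iff_of_pos_right hκ0]
    linarith [Real.exp_pos (-κ * t₂)]
  calc ∫ t in t₁..t₂, t ^ (-(1 / 2 : ℝ)) * (M * Real.exp (-(c * M ^ 2 * t)))
      ≤ (Real.sqrt t₁)⁻¹ * M * (Real.exp (-κ * t₁) / κ) := hmono.trans hint
    _ = Real.exp (-(c * M ^ 2 * t₁)) / (c * M * Real.sqrt t₁) := by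
        rw [hκ]
        have h1 : Real.exp (-(c * M ^ 2) * t₁) = Real.exp (-(c * M ^ 2 * t₁)) := by ring_nf
        rw [h1]
        field_simp

/-- **Any single scale contributes at most `2 + 1/c`**: `∫_{t₁}^{t₂} t^{-1/2} M e^{-cM²t} dt ≤ 2 + 1/c`
for `M, c > 0`, `0 < t₁ ≤ t₂` (split the interval at `t = M⁻²`: below, the previous bound with
`√(M⁻²) = M⁻¹`; above, `e^{-cM²t₁'}/(cM√t₁') ≤ 1/c` since `M√t₁' ≥ 1`).
[cite: CoiculescuPalasek2025, proof of Prop. 3.13, terms I–II] -/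
theorem integral_rpow_neg_half_mul_exp_le_const {M c t₁ t₂ : ℝ} (hM : 0 < M) (hc : 0 < c)
    (ht₁ : 0 < t₁) (h12 : t₁ ≤ t₂) :
    ∫ t in t₁..t₂, t ^ (-(1 / 2 : ℝ)) * (M * Real.exp (-(c * M ^ 2 * t))) ≤ 2 + 1 / c := by
  set s : ℝ := (M ^ 2)⁻¹ with hs
  have hs0 : 0 < s := by positivity
  have hsqrt_s : Real.sqrt s = M⁻¹ := by
    rw [hs, ← inv_pow, Real.sqrt_sq (inv_nonneg.2 hM.le)]
  have hc0 : 0 ≤ 1 / c := by positivity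
  -- the "below" bound on an interval ending at `b ≤ s`: `≤ 2 M √b ≤ 2`
  have hbelow : ∀ {a b : ℝ}, 0 < a → a ≤ b → b ≤ s →
      ∫ t in a..b, t ^ (-(1 / 2 : ℝ)) * (M * Real.exp (-(c * M ^ 2 * t))) ≤ 2 := by
    intro a b ha hab hbs
    refine (integral_rpow_neg_half_mul_exp_le_sqrt hM.le hc.le ha hab).trans ?_
    have h1 : Real.sqrt b ≤ M⁻¹ := hsqrt_s ▸ Real.sqrt_le_sqrt hbs
    calc 2 * M * Real.sqrt b ≤ 2 * M * M⁻¹ := mul_le_mul_of_nonneg_left h1 (by positivity)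
      _ = 2 := by field_simp
  -- the "above" bound on an interval starting at `a ≥ s`: `≤ 1/c`
  have habove : ∀ {a b : ℝ}, s ≤ a → a ≤ b →
      ∫ t in a..b, t ^ (-(1 / 2 : ℝ)) * (M * Real.exp (-(c * M ^ 2 * t))) ≤ 1 / c := by
    intro a b hsa hab
    have ha : 0 < a := hs0.trans_le hsa
    refine (integral_rpow_neg_half_mul_exp_le_exp hM hc ha hab).trans ?_
    have h1 : 1 ≤ M * Real.sqrt a := by
      have h2 : M⁻¹ ≤ Real.sqrt a := hsqrt_s ▸ Real.sqrt_le_sqrt hsa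
      calc (1 : ℝ) = M * M⁻¹ := by field_simp
        _ ≤ M * Real.sqrt a := mul_le_mul_of_nonneg_left h2 hM.le
    have hexp : Real.exp (-(c * M ^ 2 * a)) ≤ 1 := by
      rw [Real.exp_le_one_iff, neg_nonpos]; positivity
    have hden : c ≤ c * M * Real.sqrt a := by
      have := mul_le_mul_of_nonneg_left h1 hc.le
      rw [mul_one] at this
      linarith [mul_assoc c M (Real.sqrt a)]
    calc Real.exp (-(c * M ^ 2 * a)) / (c * M * Real.sqrt a) ≤ 1 / (c * M * Real.sqrt a) :=
          div_le_div_of_nonneg_right hexp (by positivity)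
      _ ≤ 1 / c := one_div_le_one_div_of_le hc hden
  rcases le_or_gt t₂ s with h₂ | h₂
  · -- whole interval below `s`
    linarith [hbelow ht₁ h12 h₂]
  rcases le_or_gt s t₁ with h₁ | h₁
  · -- whole interval above `s`
    have h := habove h₁ h12
    linarith
  · -- `t₁ < s < t₂`: split at `s`
    have hI := intervalIntegrable_rpow_neg_half_mul_exp (M := M) (c := c) ht₁ h₁.le
    have hJ := intervalIntegrable_rpow_neg_half_mul_exp (M := M) (c := c) hs0 h₂.le
    rw [← intervalIntegral.integral_add_adjacent_intervals hI hJ]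
    exact add_le_add (hbelow ht₁ h₁.le le_rfl) (habove le_rfl h₂.le)

variable {N : ℕ → ℝ} {ρ : ℝ}

/-- **(3.13b), the weighted `L¹` bound.** For a positive sequence of scales with
`N_{k+1} ≥ ρ N_k`, `ρ ≥ 2`, and `c > 0`, `0 < t₁ ≤ t₂`:
`∫_{t₁}^{t₂} t^{-1/2} ∑_{k<n} N_k e^{-c N_k² t} dt ≤ 6 + 1/c + 1/c² + (1 + 1/(2c)) log(t₂/t₁)/log ρ`,
uniformly in `n` — scales `N_k ≤ t₂^{-1/2}` contribute `∑ 2N_k√t₂ ≤ 4`, scales `N_k ≥ t₁^{-1/2}`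
contribute `∑ e^{-c(N_k√t₁)²}/c ≤ 1/c²`, and the `≤ 1 + log(t₂/t₁)/(2 log ρ)` scales in between at most
`2 + 1/c` each (the constant is independent of `ρ`; the slope is `O(1/log ρ)`). With
`‖v_k(t)‖_∞ ≲ N_k e^{-N_k² t}` this is `‖v‖_{L¹([t₁,t₂], t^{-1/2}dt; L^∞)} ≲ 1 + (log A)⁻¹ log(t₂/t₁)`.
[cite: CoiculescuPalasek2025, Prop. 3.13 (vl2intimelinftyinspacebound) and its proof, terms I–II] -/
theorem integral_rpow_neg_half_mul_sum_le_of_lacunary (hN : ∀ k, 0 < N k) (hρ : 2 ≤ ρ)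
    (hlac : ∀ k, ρ * N k ≤ N (k + 1)) {c : ℝ} (hc : 0 < c) {t₁ t₂ : ℝ} (ht₁ : 0 < t₁)
    (h12 : t₁ ≤ t₂) (n : ℕ) :
    ∫ t in t₁..t₂, t ^ (-(1 / 2 : ℝ)) * ∑ k ∈ Finset.range n, N k * Real.exp (-(c * N k ^ 2 * t)) ≤
      6 + 1 / c + 1 / c ^ 2 + (1 + 1 / (2 * c)) * (Real.log (t₂ / t₁) / Real.log ρ) := by
  classical
  have ht₂ : 0 < t₂ := ht₁.trans_le h12
  have hρ1 : (1 : ℝ) < ρ := by linarith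
  have hlac2 : ∀ k, 2 * N k ≤ N (k + 1) := two_mul_le_of_lacunary (fun k => (hN k).le) hρ hlac
  set J : ℕ → ℝ := fun k =>
    ∫ t in t₁..t₂, t ^ (-(1 / 2 : ℝ)) * (N k * Real.exp (-(c * N k ^ 2 * t))) with hJ
  -- exchange sum and integral
  have hswap : ∫ t in t₁..t₂, t ^ (-(1 / 2 : ℝ)) *
      ∑ k ∈ Finset.range n, N k * Real.exp (-(c * N k ^ 2 * t)) = ∑ k ∈ Finset.range n, J k := by
    simp only [hJ, Finset.mul_sum]
    exact intervalIntegral.integral_finsetSum fun k _ =>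
      intervalIntegrable_rpow_neg_half_mul_exp ht₁ h12
  rw [hswap]
  have hJ0 : ∀ k, 0 ≤ J k := fun k =>
    intervalIntegral.integral_nonneg h12 fun t ht => by
      have ht0 : 0 < t := ht₁.trans_le ht.1
      have := hN k
      positivity
  -- the three classes of scales
  set P : ℕ → Prop := fun k => N k * Real.sqrt t₂ ≤ 1 with hP
  set Q : ℕ → Prop := fun k => 1 ≤ N k * Real.sqrt t₁ with hQ
  have hs₁ : 0 < Real.sqrt t₁ := Real.sqrt_pos.2 ht₁
  have hs₂ : 0 < Real.sqrt t₂ := Real.sqrt_pos.2 ht₂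
  -- class (i): `N_k √t₂ ≤ 1`
  have h1 : ∑ k ∈ (Finset.range n).filter P, J k ≤ 4 := by
    have hb : ∀ k ∈ (Finset.range n).filter P, J k ≤ 2 * (N k * Real.sqrt t₂) := fun k _ =>
      (integral_rpow_neg_half_mul_exp_le_sqrt (hN k).le hc.le ht₁ h12).trans_eq (by ring)
    refine (Finset.sum_le_sum hb).trans ?_
    rw [← Finset.mul_sum]
    have hxl : ∀ k, 2 * (N k * Real.sqrt t₂) ≤ N (k + 1) * Real.sqrt t₂ := fun k => by
      rw [← mul_assoc]; exact mul_le_mul_of_nonneg_right (hlac2 k) hs₂.le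
    have h := sum_filter_le_le_two_mul_of_lacunary hxl zero_le_one n
    linarith
  -- class (ii): `N_k √t₂ > 1` and `N_k √t₁ ≥ 1`
  have h2 : ∑ k ∈ ((Finset.range n).filter fun k => ¬P k).filter Q, J k ≤ 1 / c ^ 2 := by
    set B := ((Finset.range n).filter fun k => ¬P k).filter Q with hB
    rcases B.eq_empty_or_nonempty with hE | hne
    · rw [hE, Finset.sum_empty]; positivity
    · set m₀ := B.min' hne with hm₀
      have hm₀B : m₀ ∈ B := Finset.min'_mem B hne
      have hy₀ : 1 ≤ N m₀ * Real.sqrt t₁ := (Finset.mem_filter.1 hm₀B).2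
      set r : ℝ := Real.exp (-c) with hr
      have hr0 : 0 ≤ r := (Real.exp_pos _).le
      have hr1 : r < 1 := Real.exp_lt_one_iff.2 (neg_neg_of_pos hc)
      have hterm : ∀ k ∈ B, J k ≤ (1 / c) * (r * r ^ (k - m₀)) := by
        intro k hk
        have hmk : m₀ ≤ k := Finset.min'_le B k hk
        have hyk : 1 ≤ N k * Real.sqrt t₁ := (Finset.mem_filter.1 hk).2
        -- `J_k ≤ e^{-c y_k²}/(c y_k) ≤ e^{-c y_k²}/c`, `y_k = N_k √t₁`
        have hb := integral_rpow_neg_half_mul_exp_le_exp (hN k) hc ht₁ h12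
        have hy2 : (N k * Real.sqrt t₁) ^ 2 = N k ^ 2 * t₁ := by
          rw [mul_pow, Real.sq_sqrt ht₁.le]
        have hstep : J k ≤ Real.exp (-(c * (N k * Real.sqrt t₁) ^ 2)) / c := by
          refine hb.trans ?_
          rw [hy2, ← mul_assoc]
          have hden : c ≤ c * N k * Real.sqrt t₁ := by
            have := mul_le_mul_of_nonneg_left hyk hc.le
            rw [mul_one] at this
            linarith [mul_assoc c (N k) (Real.sqrt t₁)]
          exact div_le_div_of_nonneg_left (Real.exp_pos _).le hc hden
        -- `y_k ≥ 2^{k-m₀}`, so `e^{-c y_k²} ≤ e^{-c 4^{k-m₀}} ≤ r^{k-m₀+1}`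
        have hge : (2 : ℝ) ^ (k - m₀) ≤ N k * Real.sqrt t₁ := by
          have h1 : (2 : ℝ) ^ (k - m₀) * N m₀ ≤ N (m₀ + (k - m₀)) :=
            pow_mul_le_of_lacunary (by norm_num) hlac2 m₀ (k - m₀)
          rw [Nat.add_sub_cancel' hmk] at h1
          calc (2 : ℝ) ^ (k - m₀) = (2 : ℝ) ^ (k - m₀) * 1 := (mul_one _).symm
            _ ≤ (2 : ℝ) ^ (k - m₀) * (N m₀ * Real.sqrt t₁) :=
                mul_le_mul_of_nonneg_left hy₀ (by positivity)
            _ = ((2 : ℝ) ^ (k - m₀) * N m₀) * Real.sqrt t₁ := by ring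
            _ ≤ N k * Real.sqrt t₁ := mul_le_mul_of_nonneg_right h1 hs₁.le
        have h4 : Real.exp (-(c * (N k * Real.sqrt t₁) ^ 2)) ≤ r ^ (k - m₀ + 1) := by
          have h5 : (4 : ℝ) ^ (k - m₀) ≤ (N k * Real.sqrt t₁) ^ 2 := by
            have : (4 : ℝ) ^ (k - m₀) = ((2 : ℝ) ^ (k - m₀)) ^ 2 := by
              rw [← pow_mul, mul_comm, pow_mul]; norm_num
            rw [this]
            exact pow_le_pow_left₀ (by positivity) hge 2
          calc Real.exp (-(c * (N k * Real.sqrt t₁) ^ 2)) ≤ Real.exp (-(c * (4 : ℝ) ^ (k - m₀))) := by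
                rw [Real.exp_le_exp, neg_le_neg_iff]
                exact mul_le_mul_of_nonneg_left h5 hc.le
            _ ≤ r ^ (k - m₀ + 1) := exp_neg_mul_four_pow_le hc.le (k - m₀)
        calc J k ≤ Real.exp (-(c * (N k * Real.sqrt t₁) ^ 2)) / c := hstep
          _ ≤ r ^ (k - m₀ + 1) / c := div_le_div_of_nonneg_right h4 hc.le
          _ = (1 / c) * (r * r ^ (k - m₀)) := by rw [pow_succ']; ring
      calc ∑ k ∈ B, J k ≤ ∑ k ∈ B, (1 / c) * (r * r ^ (k - m₀)) := Finset.sum_le_sum hterm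
        _ = (1 / c) * (r * ∑ k ∈ B, r ^ (k - m₀)) := by rw [Finset.mul_sum, Finset.mul_sum]
        _ ≤ (1 / c) * (r * (1 / (1 - r))) := by
            gcongr
            exact sum_pow_sub_le_of_forall_ge (fun k hk => Finset.min'_le B k hk) hr0 hr1
        _ = (1 / c) * (r / (1 - r)) := by ring
        _ ≤ (1 / c) * (1 / c) :=
            mul_le_mul_of_nonneg_left (exp_neg_div_one_sub_exp_neg_le hc) (by positivity)
        _ = 1 / c ^ 2 := by rw [one_div_mul_one_div, sq]
  -- class (iii): `t₂^{-1/2} < N_k < t₁^{-1/2}`: count them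
  have hlogρ : 0 < Real.log ρ := Real.log_pos hρ1
  have hlog0 : 0 ≤ Real.log (t₂ / t₁) := Real.log_nonneg ((one_le_div ht₁).2 h12)
  have h3 : ∑ k ∈ ((Finset.range n).filter fun k => ¬P k).filter (fun k => ¬Q k), J k ≤
      (2 + 1 / c) * (1 + Real.log (t₂ / t₁) / (2 * Real.log ρ)) := by
    set D := ((Finset.range n).filter fun k => ¬P k).filter (fun k => ¬Q k) with hD
    have hb : ∀ k ∈ D, J k ≤ 2 + 1 / c := fun k _ =>
      integral_rpow_neg_half_mul_exp_le_const (hN k) hc ht₁ h12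
    have hsum : ∑ k ∈ D, J k ≤ D.card * (2 + 1 / c) := by
      have h := Finset.sum_le_sum hb
      rwa [Finset.sum_const, nsmul_eq_mul] at h
    -- `D ⊆ {k : L ≤ N_k ≤ U}` with `L = (√t₂)⁻¹`, `U = (√t₁)⁻¹`
    set W := (Finset.range n).filter
      (fun k => (Real.sqrt t₂)⁻¹ ≤ N k ∧ N k ≤ (Real.sqrt t₁)⁻¹) with hW
    have hsub : D ⊆ W := by
      intro k hk
      have hk' := hk
      simp only [hD, Finset.mem_filter, hP, hQ, not_le] at hk'
      rw [hW, Finset.mem_filter]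
      refine ⟨hk'.1.1, ?_, ?_⟩
      · rw [inv_eq_one_div, div_le_iff₀ hs₂]
        exact hk'.1.2.le
      · rw [inv_eq_one_div, le_div_iff₀ hs₁]
        exact hk'.2.le
    have hcardW : ((W.card : ℕ) : ℝ) ≤ 1 + Real.log (t₂ / t₁) / (2 * Real.log ρ) := by
      have hL : 0 < (Real.sqrt t₂)⁻¹ := inv_pos.2 hs₂
      have hLU : (Real.sqrt t₂)⁻¹ ≤ (Real.sqrt t₁)⁻¹ :=
        (inv_le_inv₀ hs₂ hs₁).2 (Real.sqrt_le_sqrt h12)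
      have h := card_filter_mem_Icc_le_of_lacunary hρ1 hlac hL hLU n
      have hquot : (Real.sqrt t₁)⁻¹ / (Real.sqrt t₂)⁻¹ = Real.sqrt (t₂ / t₁) := by
        rw [inv_div_inv, Real.sqrt_div' _ ht₁.le]
      have hlog : Real.log ((Real.sqrt t₁)⁻¹ / (Real.sqrt t₂)⁻¹) = Real.log (t₂ / t₁) / 2 := by
        rw [hquot, Real.log_sqrt (div_nonneg ht₂.le ht₁.le)]
      rw [hlog, div_div] at h
      exact h
    have hcardD : ((D.card : ℕ) : ℝ) ≤ 1 + Real.log (t₂ / t₁) / (2 * Real.log ρ) :=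
      le_trans (by exact_mod_cast Finset.card_le_card hsub) hcardW
    calc ∑ k ∈ D, J k ≤ D.card * (2 + 1 / c) := hsum
      _ ≤ (1 + Real.log (t₂ / t₁) / (2 * Real.log ρ)) * (2 + 1 / c) :=
          mul_le_mul_of_nonneg_right hcardD (by positivity)
      _ = (2 + 1 / c) * (1 + Real.log (t₂ / t₁) / (2 * Real.log ρ)) := mul_comm _ _
  -- assemble
  rw [← Finset.sum_filter_add_sum_filter_not (Finset.range n) P J,
    ← Finset.sum_filter_add_sum_filter_not ((Finset.range n).filter fun k => ¬P k) Q J]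
  have hid : (2 + 1 / c) * (1 + Real.log (t₂ / t₁) / (2 * Real.log ρ)) =
      2 + 1 / c + (1 + 1 / (2 * c)) * (Real.log (t₂ / t₁) / Real.log ρ) := by
    field_simp
  linarith

/-- **(3.13b), the `L²` bound.** For `c > 0` there are `C₁, C₂ ≥ 0` (depending on `c` only) such
that for every positive sequence of scales with `N_{k+1} ≥ ρ N_k`, `ρ ≥ 2`, all `0 < t₁ ≤ t₂` and `n`:
`∫_{t₁}^{t₂} (∑_{k<n} N_k e^{-c N_k² t})² dt ≤ C₁ + C₂ log(t₂/t₁)/log ρ` ("the `L²` estimate is immediate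
by Hölder's inequality, combining the `L¹` bound with (3.13a)": pointwise
`S(t)² ≤ (C t^{-1/2}) S(t)` by `exists_sum_rpow_mul_exp_neg_le_of_lacunary` with `a = 1`, then
`integral_rpow_neg_half_mul_sum_le_of_lacunary`).
[cite: CoiculescuPalasek2025, Prop. 3.13 (vl2intimelinftyinspacebound) and its proof] -/
theorem exists_integral_sum_sq_le_of_lacunary {c : ℝ} (hc : 0 < c) :
    ∃ C₁ C₂ : ℝ, 0 ≤ C₁ ∧ 0 ≤ C₂ ∧ ∀ (N : ℕ → ℝ) (ρ : ℝ), (∀ k, 0 < N k) → 2 ≤ ρ →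
      (∀ k, ρ * N k ≤ N (k + 1)) → ∀ t₁ t₂ : ℝ, 0 < t₁ → t₁ ≤ t₂ → ∀ n : ℕ,
        ∫ t in t₁..t₂, (∑ k ∈ Finset.range n, N k * Real.exp (-(c * N k ^ 2 * t))) ^ 2 ≤
          C₁ + C₂ * (Real.log (t₂ / t₁) / Real.log ρ) := by
  obtain ⟨C, hC0, hC⟩ := exists_sum_rpow_mul_exp_neg_le_of_lacunary one_pos hc
  refine ⟨C * (6 + 1 / c + 1 / c ^ 2), C * (1 + 1 / (2 * c)), by positivity, by positivity,
    fun N ρ hN hρ hlac t₁ t₂ ht₁ h12 n => ?_⟩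
  have ht₂ : 0 < t₂ := ht₁.trans_le h12
  have hlac2 : ∀ k, 2 * N k ≤ N (k + 1) := two_mul_le_of_lacunary (fun k => (hN k).le) hρ hlac
  set S : ℝ → ℝ := fun t => ∑ k ∈ Finset.range n, N k * Real.exp (-(c * N k ^ 2 * t)) with hS
  have hS0 : ∀ t, 0 ≤ S t := fun t =>
    Finset.sum_nonneg fun k _ => by have := hN k; positivity
  -- `S t ≤ C t^{-1/2}` for `t > 0` (the case `a = 1`)
  have hSle : ∀ t, 0 < t → S t ≤ C * t ^ (-(1 / 2 : ℝ)) := by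
    intro t ht
    have h := hC N hN hlac2 t ht n
    have h1 : ∑ k ∈ Finset.range n, N k ^ (1 : ℝ) * Real.exp (-(c * N k ^ 2 * t)) = S t :=
      Finset.sum_congr rfl fun k _ => by rw [Real.rpow_one]
    rw [h1] at h
    convert h using 2
  have hScont : Continuous S :=
    continuous_finsetSum _ fun k _ => continuous_const.mul
      (Real.continuous_exp.comp ((continuous_const.mul continuous_id).neg))
  -- pointwise `S² ≤ (C t^{-1/2}) S` on `[t₁, t₂]`, then integrate
  have hmono : ∫ t in t₁..t₂, S t ^ 2 ≤ ∫ t in t₁..t₂, C * (t ^ (-(1 / 2 : ℝ)) * S t) := by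
    refine intervalIntegral.integral_mono_on h12 ((hScont.pow 2).intervalIntegrable _ _) ?_
      fun t ht => ?_
    · refine (continuousOn_const.mul (ContinuousOn.mul ?_ hScont.continuousOn)).intervalIntegrable_of_Icc h12
      exact ContinuousOn.rpow_const continuousOn_id fun t ht => Or.inl (ht₁.trans_le ht.1).ne'
    · have ht0 : 0 < t := ht₁.trans_le ht.1
      calc S t ^ 2 = S t * S t := sq _
        _ ≤ (C * t ^ (-(1 / 2 : ℝ))) * S t := mul_le_mul_of_nonneg_right (hSle t ht0) (hS0 t)
        _ = C * (t ^ (-(1 / 2 : ℝ)) * S t) := by ring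
  have hmain := integral_rpow_neg_half_mul_sum_le_of_lacunary hN hρ hlac hc ht₁ h12 n
  calc ∫ t in t₁..t₂, S t ^ 2 ≤ ∫ t in t₁..t₂, C * (t ^ (-(1 / 2 : ℝ)) * S t) := hmono
    _ = C * ∫ t in t₁..t₂, t ^ (-(1 / 2 : ℝ)) * S t := intervalIntegral.integral_const_mul _ _
    _ ≤ C * (6 + 1 / c + 1 / c ^ 2 + (1 + 1 / (2 * c)) * (Real.log (t₂ / t₁) / Real.log ρ)) :=
        mul_le_mul_of_nonneg_left hmain hC0.le
    _ = C * (6 + 1 / c + 1 / c ^ 2) + C * (1 + 1 / (2 * c)) * (Real.log (t₂ / t₁) / Real.log ρ) := by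
        ring

end WeightedL1

/-! ## The same bounds for the full series `∑'ₖ` -/

section Series

variable {N : ℕ → ℝ} {ρ : ℝ}

/-- On `[t₁, ∞)`, `t₁ > 0`, the series `∑ₖ N_k e^{-c N_k² t}` of a lacunary sequence of scales is
dominated termwise by its (summable) value at `t₁`; hence it converges uniformly and its sum is
continuous on `[t₁, t₂]`. [folklore] -/
theorem continuousOn_tsum_mul_exp_neg_of_lacunary (hN : ∀ k, 0 < N k)
    (hlac : ∀ k, 2 * N k ≤ N (k + 1)) {c : ℝ} (hc : 0 < c) {t₁ t₂ : ℝ} (ht₁ : 0 < t₁) :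
    ContinuousOn (fun t => ∑' k, N k * Real.exp (-(c * N k ^ 2 * t))) (Icc t₁ t₂) := by
  have hsum := summable_rpow_mul_exp_neg_of_lacunary hN hlac one_pos hc ht₁
  simp_rw [Real.rpow_one] at hsum
  refine continuousOn_tsum (fun k => ?_) hsum fun k t ht => ?_
  · exact (continuous_const.mul (Real.continuous_exp.comp
      ((continuous_const.mul continuous_id).neg))).continuousOn
  · have hNk := hN k
    rw [Real.norm_eq_abs, abs_of_nonneg (by positivity)]
    refine mul_le_mul_of_nonneg_left (Real.exp_le_exp.2 ?_) hNk.le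
    have : c * N k ^ 2 * t₁ ≤ c * N k ^ 2 * t := mul_le_mul_of_nonneg_left ht.1 (by positivity)
    linarith

/-- **(3.13b), the weighted `L¹` bound for the full series**: under the hypotheses of
`integral_rpow_neg_half_mul_sum_le_of_lacunary`,
`∫_{t₁}^{t₂} t^{-1/2} ∑'ₖ N_k e^{-c N_k² t} dt ≤ 6 + 1/c + 1/c² + (1 + 1/(2c)) log(t₂/t₁)/log ρ`
(termwise integration — dominated convergence with the series itself as the bound — and the
uniform bound on the partial sums). [cite: CoiculescuPalasek2025, Prop. 3.13 (vl2intimelinftyinspacebound)] -/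
theorem integral_rpow_neg_half_mul_tsum_le_of_lacunary (hN : ∀ k, 0 < N k) (hρ : 2 ≤ ρ)
    (hlac : ∀ k, ρ * N k ≤ N (k + 1)) {c : ℝ} (hc : 0 < c) {t₁ t₂ : ℝ} (ht₁ : 0 < t₁)
    (h12 : t₁ ≤ t₂) :
    ∫ t in t₁..t₂, t ^ (-(1 / 2 : ℝ)) * ∑' k, N k * Real.exp (-(c * N k ^ 2 * t)) ≤
      6 + 1 / c + 1 / c ^ 2 + (1 + 1 / (2 * c)) * (Real.log (t₂ / t₁) / Real.log ρ) := by
  have hlac2 : ∀ k, 2 * N k ≤ N (k + 1) := two_mul_le_of_lacunary (fun k => (hN k).le) hρ hlac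
  set F : ℕ → ℝ → ℝ := fun k t => t ^ (-(1 / 2 : ℝ)) * (N k * Real.exp (-(c * N k ^ 2 * t)))
    with hF
  set f : ℝ → ℝ := fun t => t ^ (-(1 / 2 : ℝ)) * ∑' k, N k * Real.exp (-(c * N k ^ 2 * t)) with hf
  -- summability of the series at every `t > 0`
  have hsumt : ∀ t, 0 < t → Summable fun k => N k * Real.exp (-(c * N k ^ 2 * t)) := by
    intro t ht
    have h := summable_rpow_mul_exp_neg_of_lacunary hN hlac2 one_pos hc ht
    simp_rw [Real.rpow_one] at h
    exact h
  -- termwise integration: `HasSum (∫ F k) (∫ f)`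
  have hcontF : ∀ k, ContinuousOn (F k) (Icc t₁ t₂) := fun k =>
    (ContinuousOn.rpow_const continuousOn_id fun t ht => Or.inl (ht₁.trans_le ht.1).ne').mul
      (continuous_const.mul (Real.continuous_exp.comp
        ((continuous_const.mul continuous_id).neg))).continuousOn
  have hcontf : ContinuousOn f (Icc t₁ t₂) :=
    (ContinuousOn.rpow_const continuousOn_id fun t ht => Or.inl (ht₁.trans_le ht.1).ne').mul
      (continuousOn_tsum_mul_exp_neg_of_lacunary hN hlac2 hc ht₁)
  have hIoc : Ι t₁ t₂ ⊆ Icc t₁ t₂ := by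
    rw [uIoc_of_le h12]; exact Ioc_subset_Icc_self
  have hF0 : ∀ k, ∀ t ∈ Ι t₁ t₂, 0 ≤ F k t := fun k t ht => by
    have ht0 : 0 < t := ht₁.trans_le (hIoc ht).1
    have := hN k
    positivity
  have hHas : HasSum (fun k => ∫ t in t₁..t₂, F k t) (∫ t in t₁..t₂, f t) := by
    refine intervalIntegral.hasSum_integral_of_dominated_convergence F
      (fun k => ((hcontF k).mono hIoc).aestronglyMeasurable measurableSet_uIoc)
      (fun k => Eventually.of_forall fun t ht => ?_)
      (Eventually.of_forall fun t ht => ?_) ?_ (Eventually.of_forall fun t ht => ?_)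
    · rw [Real.norm_eq_abs, abs_of_nonneg (hF0 k t ht)]
    · have ht0 : 0 < t := ht₁.trans_le (hIoc ht).1
      exact (hsumt t ht0).mul_left _
    · refine (hcontf.congr fun t ht => ?_).intervalIntegrable_of_Icc h12
      have ht0 : 0 < t := ht₁.trans_le ht.1
      exact ((hsumt t ht0).tsum_mul_left _)
    · have ht0 : 0 < t := ht₁.trans_le (hIoc ht).1
      exact ((hsumt t ht0).hasSum.mul_left _)
  -- the partial sums of `∫ F k` are the integrals of the partial sums, bounded uniformly
  have hpartial : ∀ n, ∑ k ∈ Finset.range n, ∫ t in t₁..t₂, F k t ≤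
      6 + 1 / c + 1 / c ^ 2 + (1 + 1 / (2 * c)) * (Real.log (t₂ / t₁) / Real.log ρ) := by
    intro n
    have h := integral_rpow_neg_half_mul_sum_le_of_lacunary hN hρ hlac hc ht₁ h12 n
    have hswap : ∫ t in t₁..t₂, t ^ (-(1 / 2 : ℝ)) *
        ∑ k ∈ Finset.range n, N k * Real.exp (-(c * N k ^ 2 * t)) =
        ∑ k ∈ Finset.range n, ∫ t in t₁..t₂, F k t := by
      simp only [hF, Finset.mul_sum]
      exact intervalIntegral.integral_finsetSum fun k _ =>
        intervalIntegrable_rpow_neg_half_mul_exp ht₁ h12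
    rwa [hswap] at h
  have hJ0 : ∀ k, 0 ≤ ∫ t in t₁..t₂, F k t := fun k =>
    intervalIntegral.integral_nonneg h12 fun t ht => by
      have ht0 : 0 < t := ht₁.trans_le ht.1
      have := hN k
      positivity
  rw [← hHas.tsum_eq]
  exact Real.tsum_le_of_sum_range_le hJ0 hpartial

/-- **(3.13b), the `L²` bound for the full series**: for `c > 0` there are `C₁, C₂ ≥ 0` such that
`∫_{t₁}^{t₂} (∑'ₖ N_k e^{-c N_k² t})² dt ≤ C₁ + C₂ log(t₂/t₁)/log ρ` for every positive sequence of
scales with `N_{k+1} ≥ ρ N_k`, `ρ ≥ 2`, and all `0 < t₁ ≤ t₂`.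
[cite: CoiculescuPalasek2025, Prop. 3.13 (vl2intimelinftyinspacebound)] -/
theorem exists_integral_tsum_sq_le_of_lacunary {c : ℝ} (hc : 0 < c) :
    ∃ C₁ C₂ : ℝ, 0 ≤ C₁ ∧ 0 ≤ C₂ ∧ ∀ (N : ℕ → ℝ) (ρ : ℝ), (∀ k, 0 < N k) → 2 ≤ ρ →
      (∀ k, ρ * N k ≤ N (k + 1)) → ∀ t₁ t₂ : ℝ, 0 < t₁ → t₁ ≤ t₂ →
        ∫ t in t₁..t₂, (∑' k, N k * Real.exp (-(c * N k ^ 2 * t))) ^ 2 ≤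
          C₁ + C₂ * (Real.log (t₂ / t₁) / Real.log ρ) := by
  obtain ⟨C, hC0, hC⟩ := exists_tsum_rpow_mul_exp_neg_le_of_lacunary one_pos hc
  refine ⟨C * (6 + 1 / c + 1 / c ^ 2), C * (1 + 1 / (2 * c)), by positivity, by positivity,
    fun N ρ hN hρ hlac t₁ t₂ ht₁ h12 => ?_⟩
  have ht₂ : 0 < t₂ := ht₁.trans_le h12
  have hlac2 : ∀ k, 2 * N k ≤ N (k + 1) := two_mul_le_of_lacunary (fun k => (hN k).le) hρ hlac
  set S : ℝ → ℝ := fun t => ∑' k, N k * Real.exp (-(c * N k ^ 2 * t)) with hS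
  have hS0 : ∀ t, 0 ≤ S t := fun t =>
    tsum_nonneg fun k => by have := hN k; positivity
  -- `S t ≤ C t^{-1/2}` for `t > 0`
  have hSle : ∀ t, 0 < t → S t ≤ C * t ^ (-(1 / 2 : ℝ)) := by
    intro t ht
    have h := hC N hN hlac2 t ht
    have h1 : ∑' k, N k ^ (1 : ℝ) * Real.exp (-(c * N k ^ 2 * t)) = S t :=
      tsum_congr fun k => by rw [Real.rpow_one]
    rw [h1] at h
    refine h.trans ?_
    have hexp : Real.exp (-(c / 2 * N 0 ^ 2 * t)) ≤ 1 := by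
      rw [Real.exp_le_one_iff, neg_nonpos]; positivity
    have h2 : 0 ≤ C * t ^ (-(1 / 2 : ℝ)) := by positivity
    calc C * t ^ (-((1 : ℝ) / 2)) * Real.exp (-(c / 2 * N 0 ^ 2 * t))
        ≤ C * t ^ (-((1 : ℝ) / 2)) * 1 := by gcongr
      _ = C * t ^ (-(1 / 2 : ℝ)) := by ring
  have hScont : ContinuousOn S (Icc t₁ t₂) :=
    continuousOn_tsum_mul_exp_neg_of_lacunary hN hlac2 hc ht₁
  have hpow : ContinuousOn (fun t : ℝ => t ^ (-(1 / 2 : ℝ))) (Icc t₁ t₂) :=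
    ContinuousOn.rpow_const continuousOn_id fun t ht => Or.inl (ht₁.trans_le ht.1).ne'
  have hmono : ∫ t in t₁..t₂, S t ^ 2 ≤ ∫ t in t₁..t₂, C * (t ^ (-(1 / 2 : ℝ)) * S t) := by
    refine intervalIntegral.integral_mono_on h12 ((hScont.pow 2).intervalIntegrable_of_Icc h12)
      ((continuousOn_const.mul (hpow.mul hScont)).intervalIntegrable_of_Icc h12) fun t ht => ?_
    have ht0 : 0 < t := ht₁.trans_le ht.1
    calc S t ^ 2 = S t * S t := sq _
      _ ≤ (C * t ^ (-(1 / 2 : ℝ))) * S t := mul_le_mul_of_nonneg_right (hSle t ht0) (hS0 t)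
      _ = C * (t ^ (-(1 / 2 : ℝ)) * S t) := by ring
  have hmain := integral_rpow_neg_half_mul_tsum_le_of_lacunary hN hρ hlac hc ht₁ h12
  calc ∫ t in t₁..t₂, S t ^ 2 ≤ ∫ t in t₁..t₂, C * (t ^ (-(1 / 2 : ℝ)) * S t) := hmono
    _ = C * ∫ t in t₁..t₂, t ^ (-(1 / 2 : ℝ)) * S t := intervalIntegral.integral_const_mul _ _
    _ ≤ C * (6 + 1 / c + 1 / c ^ 2 + (1 + 1 / (2 * c)) * (Real.log (t₂ / t₁) / Real.log ρ)) :=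
        mul_le_mul_of_nonneg_left hmain hC0.le
    _ = C * (6 + 1 / c + 1 / c ^ 2) + C * (1 + 1 / (2 * c)) * (Real.log (t₂ / t₁) / Real.log ρ) := by
        ring

end Series

end Literature.Analysis.FluidPDE
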